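import Summits.AnomalousDissipation.AnomalousDissipation.Theses.WazewskiBlock
import Summits.AnomalousDissipation.AnomalousDissipation.Theses.Correlation
import Summits.AnomalousDissipation.AnomalousDissipation.Theorems.WazewskiBlockGalerkinTrapToLerayHopf
import Summits.AnomalousDissipation.AnomalousDissipation.Theorems.WazewskiBlockPointwiseFloorToSummit
import Literature.Analysis.FluidPDE.NSGalerkinTrajectory

/-!
# Route `WazewskiBlock`, crux `UniformWorkFloorTrap` (stmt-AnomalousDissipation-10353):
# the cap-free Leray–Hopf limit, and the glue of the rank-3 crux to the summit

Definition-free support file of the line `Sketch` (lead c2).  The crux asks for a mean-zero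
Galerkin-mode force `f`, constants `E, ε₀, ν₀ > 0` and, for every `0 < ν ≤ ν₀` and every order
`N ≥ N₀(ν)`, a global Galerkin trajectory of order `N` trapped for all `t ≥ 0` in the block
`B = {kineticEnergy ≤ E} ∩ {(f, ·) ≥ ε₀}` — the block of the sibling crux `UniformGalerkinTrap`
WITHOUT its enstrophy cap.  The route docstring says: "if only this closes, the route needs a
no-leakage statement for the Galerkin-limit family (to be filed then)".  Kernel-checked here:

* `uniformWorkFloorTrap_of_uniformGalerkinTrap` — rank 2 ⇒ rank 3 (drop the enstrophy face).
* `isHopfGalerkinFamily_of_trapped` — trapped Galerkin trajectories of orders `n + N₀` with the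
  steady force `f` form an `IsHopfGalerkinFamily` (reference datum the constant field of energy
  `2E`); hence (`IsHopfGalerkinFamily.lintegral_eGradNormSq_le`, Robinson–Rodrigo–Sadowski 2016,
  (4.9)) their dissipation over `(0, 1)` is bounded UNIFORMLY in the order:
  `∫₀¹ ‖∇U n‖² ≤ (2E + 2‖f‖²_{L²((0,1)×𝕋³)}) / ν`.
* `exists_mem_Ioo_le_of_lintegral_le` + the **time shift** (`Torus.IsGalerkinTrajectory.comp_add_right`,
  the Galerkin system with a steady force is autonomous): each trapped trajectory may be replaced
  by a trapped one whose DATUM has enstrophy below that uniform level `+ 1` (Chebyshev on `(0, 1)`).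
* `exists_isGlobalLerayHopf_of_trapped` — **the cap-free Hopf–Galerkin limit** at fixed `ν > 0`:
  trapped Galerkin trajectories of all orders `N ≥ N₀` (no enstrophy cap) have a global Leray–Hopf
  limit with `kineticEnergy (u t) ≤ E` and `ε₀ ≤ (f, u t)` for all `t ≥ 0`.  Proof: Hopf's
  compactness argument exactly as in the route's proved support `GalerkinTrapToLerayHopf_proof`
  (Robinson–Rodrigo–Sadowski 2016, Thm. 4.4 Steps 3–4, Thm. 4.6, Cor. 4.7, Thm. 4.11;
  Constantin–Foias 1988, Ch. 8) — the enstrophy cap was used there only to make the DATA converge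
  strongly in `L²` (Rellich), and the time-shifted data are bounded in `H¹` uniformly in `N`.
* `uniformWorkFloorTrap_lerayHopfFamily` — the crux implies, for EVERY `0 < ν ≤ ν₀`, a global
  Leray–Hopf solution with the two pointwise-in-time bounds (the route's thesis
  `PointwiseFloorFamily` minus its no-leakage clause, at all small viscosities).
* `correlationPersistence_of_uniformWorkFloorTrap` — **cross-route**: the crux implies route
  `Correlation`'s rank-2 crux `CorrelationPersistence` (stmt-AnomalousDissipation-0201: bounded
  mean energy and a positive mean work floor along `ν_j → 0`), by Cesàro bookkeeping
  (`pointwiseFloor_le_longTimeAvgSup`).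
* `pointwiseFloorFamily_of_uniformWorkFloorTrap_of_noMeanLeakage`,
  `anomalousDissipation_of_uniformWorkFloorTrap_of_noMeanLeakage` — **the glue the planner asked
  for**: the "no-leakage statement" is the EXISTING item `Correlation.NoMeanLeakage`
  (stmt-AnomalousDissipation-14265, mean energy equality of Leray–Hopf solutions at positive
  viscosity), and `UniformWorkFloorTrap → NoMeanLeakage → AnomalousDissipation` through the
  route's proved frame `pointwiseFloorToSummit_proof`.

References: Robinson–Rodrigo–Sadowski 2016, §4 (Hopf–Galerkin limit); Constantin–Foias 1988,
Ch. 8; Foias–Manley–Rosa–Temam 2001, Ch. II (12.38)–(12.39) (Cesàro means); Doering–Foias 2002 §2.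
-/

noncomputable section

-- `Summit.<Summit>.<Problem>` is the tree's mandated summit-side namespace (CONVENTIONS §2); deliberate duplicate.
set_option linter.dupNamespace false

namespace Summit.AnomalousDissipation.AnomalousDissipation.Theorems.UniformWorkFloorTrap

open scoped InnerProductSpace RealInnerProductSpace ENNReal NNReal
open MeasureTheory Filter Set Topology Function UnitAddTorus
open Literature.Analysis.FunctionSpaces Literature.Analysis.FunctionSpaces.Torus
open Literature.Analysis.FluidPDE Literature.Analysis.FluidPDE.Torus
open Summit.AnomalousDissipation.AnomalousDissipation.Theses.WazewskiBlock
  (UniformWorkFloorTrap UniformGalerkinTrap PointwiseFloorFamily)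
open Summit.AnomalousDissipation.AnomalousDissipation.Theses.Correlation
  (CorrelationPersistence NoMeanLeakage)

variable {ν : ℝ} {f : UnitAddTorus (Fin 3) → EuclideanSpace ℝ (Fin 3)}

/-! ## §1 Rank 2 ⇒ rank 3 -/

/-- **`UniformGalerkinTrap → UniformWorkFloorTrap`**: the rank-2 crux of the route (block with
enstrophy cap `eGradNormSq (U t) ≤ G(ν)`) implies the rank-3 crux (the same block without the
cap) — forget `G` and the third face. [folklore] -/
theorem uniformWorkFloorTrap_of_uniformGalerkinTrap (h : UniformGalerkinTrap) :
    UniformWorkFloorTrap := by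
  obtain ⟨m, f, hf, hmean, E, ε₀, ν₀, hε₀, hν₀, h⟩ := h
  refine ⟨m, f, hf, hmean, E, ε₀, ν₀, hε₀, hν₀, fun ν hν hνle => ?_⟩
  obtain ⟨_G, N₀, hN⟩ := h ν hν hνle
  refine ⟨N₀, fun N hN₀ => ?_⟩
  obtain ⟨U, hcl, htrap⟩ := hN N hN₀
  exact ⟨U, hcl, fun t ht => ⟨(htrap t ht).1, (htrap t ht).2.1⟩⟩

/-! ## §2 Trapped trajectories form a Hopf–Galerkin family; Chebyshev in time -/

/-- **Trapped Galerkin trajectories form a Hopf–Galerkin family.**  Galerkin trajectories `U n`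
of orders `n + N₀` driven by the steady smooth force `f`, with data of energy
`kineticEnergy (U n 0) ≤ E` (`E ≥ 0`), satisfy every clause of `IsHopfGalerkinFamily` with the
steady forces `F n = f` and the constant reference datum `x ↦ √(2E) e₀` (of energy `2E`).
[cite: RobinsonRodrigoSadowski2016, Thm. 4.4 Steps 1–2, (4.4)] -/
theorem isHopfGalerkinFamily_of_trapped {N₀ : ℕ} {E : ℝ} (hf : IsSmooth f) (hE : 0 ≤ E)
    {U : ℕ → ℝ → UnitAddTorus (Fin 3) → EuclideanSpace ℝ (Fin 3)}
    (hU : ∀ n, Torus.IsGalerkinTrajectory ν f (n + N₀) (U n))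
    (hKE : ∀ n, kineticEnergy (U n 0) ≤ E) :
    IsHopfGalerkinFamily ν (fun _ => f)
      (fun _ => EuclideanSpace.single (0 : Fin 3) (Real.sqrt (2 * E))) (fun n => n + N₀)
      (fun _ _ => f) U where
  tendsto_order := tendsto_add_atTop_nat N₀
  smooth_force := fun _ => MomentParity.contDiff_stLift_const hf
  tendsto_force := fun T _ => by
    simp only [sub_self, enorm_zero, ne_eq, OfNat.ofNat_ne_zero, not_false_eq_true, zero_pow,
      lintegral_const, zero_mul]
    exact tendsto_const_nhds
  continuousOn := fun n => (hU n).continuousOn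
  isGalerkinMode := fun n t ht => (hU n).isGalerkinMode t ht
  isWeaklyDivFree := fun n t ht => (hU n).isWeaklyDivFree t ht
  galerkin := fun n a ha s t hs hst => (hU n).galerkin a ha s t hs hst
  energy_eq := fun n s t hs hst => (hU n).energy_eq s t hs hst
  initial_bound := fun n => by
    have h := hKE n
    simp only [kineticEnergy] at h
    rw [MomentParity.integral_norm_sq_const_single, Real.sq_sqrt (by positivity)]
    linarith

/-- **Chebyshev in time.** If `∫₀¹ g ≤ K` (`K ≥ 0` real, Lebesgue integral over `(0, 1)`), then
`g τ ≤ K + 1` for some `τ ∈ (0, 1)` — otherwise the integral over a set of measure one would be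
`≥ K + 1 > K`. [folklore] -/
theorem exists_mem_Ioo_le_of_lintegral_le {g : ℝ → ℝ≥0∞} {K : ℝ} (hK : 0 ≤ K)
    (h : (∫⁻ τ in Ioo (0 : ℝ) 1, g τ) ≤ ENNReal.ofReal K) :
    ∃ τ ∈ Ioo (0 : ℝ) 1, g τ ≤ ENNReal.ofReal (K + 1) := by
  by_contra hcon
  push Not at hcon
  have hlow : ENNReal.ofReal (K + 1) ≤ ∫⁻ τ in Ioo (0 : ℝ) 1, g τ := by
    have h' := setLIntegral_mono' (μ := volume) measurableSet_Ioo
      (f := fun _ => ENNReal.ofReal (K + 1)) (g := g) fun τ hτ => (hcon τ hτ).le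
    rwa [setLIntegral_const, Real.volume_Ioo, sub_zero, ENNReal.ofReal_one, mul_one] at h'
  have hlt : ENNReal.ofReal K < ENNReal.ofReal (K + 1) :=
    (ENNReal.ofReal_lt_ofReal_iff (by linarith)).2 (by linarith)
  exact lt_irrefl _ ((hlow.trans h).trans_lt hlt)

/-! ## §3 The cap-free Hopf–Galerkin limit of a trapped family -/

/-- **The cap-free Hopf–Galerkin limit** (the analogue of the route's proved support
`GalerkinTrapToLerayHopf` without the enstrophy face).  Fix `ν > 0`, a smooth force `f` and
constants `E`, `ε₀`.  If for every order `N ≥ N₀` some global Galerkin trajectory of order `N`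
driven by `f` stays for all `t ≥ 0` in `{kineticEnergy ≤ E} ∩ {(f, ·) ≥ ε₀}`, then a global
Leray–Hopf solution of the Navier–Stokes equations with force `f` satisfies the same two bounds for
all `t ≥ 0`.  Proof: the trapped trajectories of orders `n + N₀` form a Hopf–Galerkin family, so
their dissipation over `(0, 1)` is bounded uniformly, `∫₀¹‖∇U n‖² ≤ K := (2E + 2A)/ν`
(`IsHopfGalerkinFamily.lintegral_eGradNormSq_le`, `A = ‖f‖²_{L²((0,1)×𝕋³)}`); by Chebyshev some
slice `U n (τ n)`, `τ n ∈ (0, 1)`, has `‖∇U n (τ n)‖² ≤ K + 1`, and the time shifts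
`V n t = U n (t + τ n)` are again trapped Galerkin trajectories (autonomy) forming a Hopf–Galerkin
family whose DATA have enstrophy `≤ K + 1`; extract a coefficientwise convergent subsequence
(`exists_limitField`); the data converge strongly in `L²` by Rellich
(`tendsto_eLpNorm_sub_of_tendsto_mFourierCoeff_of_eGradNormSq_le`), so `isGlobalLerayHopf_limit`
applies; the energy cap passes to the limit by lower semicontinuity
(`integral_norm_sq_le_of_tendsto_mFourierCoeff`) and the work floor by weak `L²` convergence at
every time (`tendsto_integral_inner_limit`).
[cite: RobinsonRodrigoSadowski2016, Thm. 4.4 Steps 3–4, Thm. 4.6, Cor. 4.7] -/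
theorem exists_isGlobalLerayHopf_of_trapped {N₀ : ℕ} {E ε₀ : ℝ} (hν : 0 < ν) (hf : IsSmooth f)
    (htrap : ∀ N : ℕ, N₀ ≤ N → ∃ U : ℝ → UnitAddTorus (Fin 3) → EuclideanSpace ℝ (Fin 3),
      Torus.IsGalerkinTrajectory ν f N U ∧
        ∀ t : ℝ, 0 ≤ t → kineticEnergy (U t) ≤ E ∧ ε₀ ≤ ∫ x, ⟪f x, U t x⟫_ℝ) :
    ∃ (u₀ : UnitAddTorus (Fin 3) → EuclideanSpace ℝ (Fin 3))
      (u : ℝ → UnitAddTorus (Fin 3) → EuclideanSpace ℝ (Fin 3)),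
      IsGlobalLerayHopf ν (fun _ => f) u₀ u ∧
        ∀ t : ℝ, 0 ≤ t → kineticEnergy (u t) ≤ E ∧ ε₀ ≤ ∫ x, ⟪f x, u t x⟫_ℝ := by
  have hf2 : MemLp f 2 volume := hf.memLp 2
  -- the trapped trajectories of orders `n + N₀`
  choose U hU hbox using fun n : ℕ => htrap (n + N₀) (Nat.le_add_left N₀ n)
  -- `E ≥ 0` (the block is nonempty)
  have hE : 0 ≤ E := (kineticEnergy_nonneg (U 0 0)).trans ((hbox 0) 0 le_rfl).1
  -- bookkeeping for the steady force and the reference datum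
  set u₀ : UnitAddTorus (Fin 3) → EuclideanSpace ℝ (Fin 3) :=
    fun _ => EuclideanSpace.single (0 : Fin 3) (Real.sqrt (2 * E)) with hu₀def
  have hu₀ : MemLp u₀ 2 volume := memLp_const _
  have hu₀E : ∫ x, ‖u₀ x‖ ^ 2 = 2 * E := by
    rw [hu₀def, MomentParity.integral_norm_sq_const_single, Real.sq_sqrt (by positivity)]
  have hfm : AEStronglyMeasurable (stLift fun _ : ℝ => f) (volume.restrict (Ioi 0 ×ˢ univ)) :=
    MomentParity.aestronglyMeasurable_stLift_const hf _
  have hf₂ : ∀ T : ℝ, 0 < T → ∫⁻ _ in Ioo (0 : ℝ) T, ∫⁻ x, ‖f x‖ₑ ^ 2 < ⊤ := fun T _ =>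
    MomentParity.lintegral_force_lt_top hf T
  -- Step 1: the unshifted family and its uniform dissipation bound over `(0, 1)`
  have hS₀ : IsHopfGalerkinFamily ν (fun _ => f) u₀ (fun n => n + N₀) (fun _ _ => f) U :=
    isHopfGalerkinFamily_of_trapped hf hE hU fun n => ((hbox n) 0 le_rfl).1
  set A : ℝ≥0∞ := ∫⁻ _ in Ioo (0 : ℝ) 1, ∫⁻ x, ‖f x‖ₑ ^ 2 with hA
  have hAfin : A ≠ ⊤ := (hf₂ 1 one_pos).ne
  set K : ℝ := ((∫ x, ‖u₀ x‖ ^ 2) + 2 * 1 * A.toReal) / ν with hK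
  have hK0 : 0 ≤ K := by
    rw [hK, hu₀E]
    positivity
  have hdiss : ∀ n, (∫⁻ τ in Ioo (0 : ℝ) 1, eGradNormSq (U n τ)) ≤ ENNReal.ofReal K := fun n =>
    hS₀.lintegral_eGradNormSq_le hν hu₀ one_pos hAfin n le_rfl
  -- Step 2: Chebyshev in time and the time shift
  have hτ : ∀ n, ∃ τ ∈ Ioo (0 : ℝ) 1, eGradNormSq (U n τ) ≤ ENNReal.ofReal (K + 1) := fun n =>
    exists_mem_Ioo_le_of_lintegral_le hK0 (hdiss n)
  choose τ hτI hτg using hτ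
  set V : ℕ → ℝ → UnitAddTorus (Fin 3) → EuclideanSpace ℝ (Fin 3) :=
    fun n t => U n (t + τ n) with hVdef
  have hV : ∀ n, Torus.IsGalerkinTrajectory ν f (n + N₀) (V n) := fun n =>
    (hU n).comp_add_right (hτI n).1.le
  have hVbox : ∀ n (t : ℝ), 0 ≤ t → kineticEnergy (V n t) ≤ E ∧ ε₀ ≤ ∫ x, ⟪f x, V n t x⟫_ℝ :=
    fun n t ht => hbox n (t + τ n) (add_nonneg ht (hτI n).1.le)
  have hV0 : ∀ n, eGradNormSq (V n 0) ≤ ((Real.toNNReal (K + 1) : ℝ≥0) : ℝ≥0∞) := fun n => by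
    have h := hτg n
    simp only [hVdef, zero_add]
    exact h
  -- Step 3: the shifted family, its limit field along a subsequence
  have hS : IsHopfGalerkinFamily ν (fun _ => f) u₀ (fun n => n + N₀) (fun _ _ => f) V :=
    isHopfGalerkinFamily_of_trapped hf hE hV fun n => ((hVbox n) 0 le_rfl).1
  obtain ⟨φ, hφ, u, hum, hu, hc⟩ := hS.exists_limitField hν.le hu₀ hfm hf₂
  have hS' := hS.comp_strictMono hφ
  have hc' : ∀ t, 0 ≤ t → ∀ k, Tendsto
      (fun j => mFourierCoeff (EuclideanSpace.complexify ∘ (V ∘ φ) j t) k) atTop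
      (𝓝 (mFourierCoeff (EuclideanSpace.complexify ∘ u t) k)) := hc
  -- strong convergence of the data (Rellich via the enstrophy bound `K + 1` of the shifted data)
  have h0 : Tendsto (fun j => eLpNorm ((V ∘ φ) j 0 - u 0) 2 volume) atTop (𝓝 0) :=
    tendsto_eLpNorm_sub_of_tendsto_mFourierCoeff_of_eGradNormSq_le
      (fun j => hS'.memLp_slice j le_rfl) (hu 0 le_rfl) (fun j => hV0 (φ j)) (hc' 0 le_rfl)
  -- the limit is a global Leray–Hopf solution from `u 0`
  have hLH : IsGlobalLerayHopf ν (fun _ => f) (u 0) u :=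
    hS'.isGlobalLerayHopf_limit hν hu₀ hfm hf₂ hum hu hc' h0
  refine ⟨u 0, u, hLH, fun t ht => ⟨?_, ?_⟩⟩
  · -- energy cap: Parseval and lower semicontinuity
    have hY : ∀ j, ∫ x, ‖(V ∘ φ) j t x‖ ^ 2 ≤ 2 * E := fun j => by
      have h := ((hVbox (φ j)) t ht).1
      simp only [kineticEnergy] at h
      simp only [Function.comp_apply]
      linarith
    have h := integral_norm_sq_le_of_tendsto_mFourierCoeff (fun j => hS'.memLp_slice j ht) (hu t ht)
      hY (hc' t ht)
    simp only [kineticEnergy]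
    linarith
  · -- work floor: weak `L²` convergence at time `t`
    have hw := hS'.tendsto_integral_inner_limit hν.le hu₀ hfm hf₂ hu hc' hf2 ht
    have hcomm : ∀ v : UnitAddTorus (Fin 3) → EuclideanSpace ℝ (Fin 3),
        (∫ x, ⟪f x, v x⟫_ℝ) = ∫ x, ⟪v x, f x⟫_ℝ := fun v =>
      integral_congr_ae (ae_of_all _ fun x => real_inner_comm _ _)
    rw [hcomm]
    refine ge_of_tendsto' hw fun j => ?_
    rw [← hcomm]
    exact ((hVbox (φ j)) t ht).2

/-! ## §4 Consequences of the crux -/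

/-- **The crux implies a pointwise-floor Leray–Hopf family at every small viscosity**: its witness
`(f, E, ε₀, ν₀)` gives, for EVERY `0 < ν ≤ ν₀`, a global Leray–Hopf solution `u` of the
Navier–Stokes equations with force `f` such that `kineticEnergy (u t) ≤ E` and `ε₀ ≤ (f, u t)` for
all `t ≥ 0` (`exists_isGlobalLerayHopf_of_trapped` at each `ν`; the crux's clause block is
`Torus.IsGalerkinTrajectory`, `Torus.isGalerkinTrajectory_iff`).  This is the route's thesis
`PointwiseFloorFamily` except for its no-leakage clause. [folklore] -/
theorem uniformWorkFloorTrap_lerayHopfFamily :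
    UniformWorkFloorTrap → ∃ (m : ℕ) (f : UnitAddTorus (Fin 3) → EuclideanSpace ℝ (Fin 3)),
      IsGalerkinMode m f ∧ HasZeroMean f ∧ ∃ (E ε₀ ν₀ : ℝ), 0 < ε₀ ∧ 0 < ν₀ ∧
        ∀ ν : ℝ, 0 < ν → ν ≤ ν₀ →
          ∃ (u₀ : UnitAddTorus (Fin 3) → EuclideanSpace ℝ (Fin 3))
            (u : ℝ → UnitAddTorus (Fin 3) → EuclideanSpace ℝ (Fin 3)),
            IsGlobalLerayHopf ν (fun _ => f) u₀ u ∧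
              ∀ t : ℝ, 0 ≤ t → kineticEnergy (u t) ≤ E ∧ ε₀ ≤ ∫ x, ⟪f x, u t x⟫_ℝ := by
  rintro ⟨m, f, hf, hmean, E, ε₀, ν₀, hε₀, hν₀, h⟩
  refine ⟨m, f, hf, hmean, E, ε₀, ν₀, hε₀, hν₀, fun ν hν hνle => ?_⟩
  obtain ⟨N₀, hN⟩ := h ν hν hνle
  refine exists_isGlobalLerayHopf_of_trapped (N₀ := N₀) hν hf.1 fun N hN₀ => ?_
  obtain ⟨U, hcl, htrap⟩ := hN N hN₀
  exact ⟨U, Torus.isGalerkinTrajectory_iff.2 hcl, htrap⟩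

/-- The viscosities `ν j = ν₀ / (j + 1)` lie in `(0, ν₀]` and tend to `0`. [folklore] -/
theorem viscositySeq_spec {ν₀ : ℝ} (hν₀ : 0 < ν₀) :
    (∀ j : ℕ, 0 < ν₀ / ((j : ℝ) + 1)) ∧ (∀ j : ℕ, ν₀ / ((j : ℝ) + 1) ≤ ν₀) ∧
      Tendsto (fun j : ℕ => ν₀ / ((j : ℝ) + 1)) atTop (𝓝 0) := by
  refine ⟨fun j => div_pos hν₀ (Nat.cast_add_one_pos j),
    fun j => div_le_self hν₀.le (by linarith [(Nat.cast_nonneg j : (0 : ℝ) ≤ j)]), ?_⟩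
  have h1 : Tendsto (fun j : ℕ => ((j : ℝ) + 1)) atTop atTop :=
    tendsto_atTop_add_const_right _ 1 tendsto_natCast_atTop_atTop
  exact h1.const_div_atTop ν₀

/-- **Cross-route: `UniformWorkFloorTrap → Correlation.CorrelationPersistence`** (this route's
rank-3 crux implies route `Correlation`'s rank-2 crux, stmt-AnomalousDissipation-0201).  Along
`ν_j := ν₀ / (j + 1) → 0` take the Leray–Hopf solutions of `uniformWorkFloorTrap_lerayHopfFamily`;
the pointwise bounds give `meanEnergy (u j) ≤ 2E` (`longTimeAvgSup_le_const`) and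
`ε₀ ≤ ⟨(f, u j)⟩` (`pointwiseFloor_le_longTimeAvgSup`, fed by `pointwiseFloor_integrableOn_work`
and `pointwiseFloor_work_le`) — Foias–Manley–Rosa–Temam 2001, Ch. II (12.38)–(12.39). [folklore] -/
theorem correlationPersistence_of_uniformWorkFloorTrap (h : UniformWorkFloorTrap) :
    CorrelationPersistence := by
  obtain ⟨m, f, hf, hmean, E, ε₀, ν₀, hε₀, hν₀, h⟩ := uniformWorkFloorTrap_lerayHopfFamily h
  obtain ⟨hνpos, hνle, hν0⟩ := viscositySeq_spec hν₀
  choose u₀ u hLH hpt using fun j : ℕ => h (ν₀ / ((j : ℝ) + 1)) (hνpos j) (hνle j)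
  have hf2 : MemLp f 2 volume := hf.isSmooth.memLp 2
  refine ⟨f, hf.isSmooth, hf.isDivFree, hmean, fun j => ν₀ / ((j : ℝ) + 1), u₀, u, hνpos, hν0,
    hLH, ⟨2 * E, fun j => ?_⟩, ε₀, hε₀, fun j => ?_⟩
  · -- bounded mean energy: `meanEnergy (u j) ≤ 2E`
    rw [meanEnergy_eq_longTimeAvgSup]
    refine longTimeAvgSup_le_const (fun t => integral_nonneg fun x => sq_nonneg _) fun t ht => ?_
    have h := (hpt j t ht.le).1
    unfold kineticEnergy at h
    show ∫ x, ‖u j t x‖ ^ 2 ≤ 2 * E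
    linarith
  · -- mean work floor: `ε₀ ≤ ⟨(f, u j)⟩`
    have hup : ∀ t, 0 ≤ t → ∫ x, ⟪f x, u j t x⟫_ℝ ≤ 2⁻¹ * ((∫ x, ‖f x‖ ^ 2) + 2 * E) :=
      fun t ht => pointwiseFloor_work_le hf2 (hLH j) (fun s hs => (hpt j s hs).1) ht
    have hlow : ∀ t, 0 ≤ t → ε₀ ≤ ∫ x, ⟪f x, u j t x⟫_ℝ := fun t ht => (hpt j t ht).2
    exact pointwiseFloor_le_longTimeAvgSup
      (fun T hT => pointwiseFloor_integrableOn_work hf2 (hLH j) hε₀ hlow hup hT) hlow hup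

/-- **The thesis from the crux and no-leakage**: `UniformWorkFloorTrap → NoMeanLeakage →
PointwiseFloorFamily`.  The no-leakage statement the route asks for "if only this crux closes" is
route `Correlation`'s item `NoMeanLeakage` (stmt-AnomalousDissipation-14265: for every `ν > 0`,
every smooth divergence-free mean-zero steady force and every global Leray–Hopf solution,
`⟨(f, u)⟩ ≤ ν⟨‖∇u‖²⟩`); with it, the Leray–Hopf family of `uniformWorkFloorTrap_lerayHopfFamily`
along `ν_j = ν₀/(j+1)` is a witness of `PointwiseFloorFamily`. [folklore] -/
theorem pointwiseFloorFamily_of_uniformWorkFloorTrap_of_noMeanLeakage (h : UniformWorkFloorTrap)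
    (hNL : NoMeanLeakage) : PointwiseFloorFamily := by
  obtain ⟨m, f, hf, hmean, E, ε₀, ν₀, hε₀, hν₀, h⟩ := uniformWorkFloorTrap_lerayHopfFamily h
  obtain ⟨hνpos, hνle, hν0⟩ := viscositySeq_spec hν₀
  choose u₀ u hLH hpt using fun j : ℕ => h (ν₀ / ((j : ℝ) + 1)) (hνpos j) (hνle j)
  exact ⟨f, hf.isSmooth, hf.isDivFree, hmean, fun j => ν₀ / ((j : ℝ) + 1), u₀, u, hνpos, hν0, hLH,
    E, ε₀, hε₀, fun j t ht => hpt j t ht,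
    fun j => hNL _ f (u₀ j) (u j) (hνpos j) hf.isSmooth hf.isDivFree hmean (hLH j)⟩

/-- **The summit from the rank-3 crux and no-leakage**:
`UniformWorkFloorTrap → Correlation.NoMeanLeakage → AnomalousDissipation` — a second closing chain
of route `WazewskiBlock` (besides `Assembly`, which uses the capped crux `UniformGalerkinTrap`),
through `pointwiseFloorFamily_of_uniformWorkFloorTrap_of_noMeanLeakage` and the route's proved
frame `pointwiseFloorToSummit_proof : PointwiseFloorFamily → AnomalousDissipation`. [folklore] -/
theorem anomalousDissipation_of_uniformWorkFloorTrap_of_noMeanLeakage (h : UniformWorkFloorTrap)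
    (hNL : NoMeanLeakage) : _root_.AnomalousDissipation :=
  pointwiseFloorToSummit_proof (pointwiseFloorFamily_of_uniformWorkFloorTrap_of_noMeanLeakage h hNL)

end Summit.AnomalousDissipation.AnomalousDissipation.Theorems.UniformWorkFloorTrap

end
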